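import Summits.QuantumFields.YangMills.Theorems.UV3AxialLaunderingFreeSlot
import HarnessLib

/-!
# R3 (cell `ym3-torus`, YM₃ on T³ — a ladder RUNG, NOT d = 4, NOT infinite volume, NOT a mass gap, NOT the Clay problem) —
# **LAUNDERING BY TRANSLATE SLOTS, ABSTRACT CORE: if a measurable map `Φ : X → (coarse fields)` intertwines a family of `μ`-preserving «shears» `σ_κ` of the source
# with TWO-SIDED COORDINATEWISE TRANSLATES of the coarse field — `Φ(σ_κ x) = (A_C(x)·κ_C·B_C(x))_C`, the translates depending on the point `x` — then `Φ_* μ` is an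
# EXACT multiple of product Haar, `μ(univ)•dU`; with spectators, densities and signed integrands**

Width seat `ym3-torus-px8` g12 on crux `stmt-QuantumFields-19936` `UnitScaleTilt.HistoryTailL` (`--supports`, helper; THEOREMS ONLY, 0 `def`, 0 `sorry`).  The Tonelli core
behind ✓`UV3AxialLaunderingFreeSlot` (p755566) ∕ ✓`…Spectator` (p756046) ∕ `…Integral`, extracted for ARBITRARY maps `Φ` — what a multi-level composite of block averagings
(guarded at some coordinates, axial at others) actually offers: every target coordinate carries one private letter of the source, two-sidedly, with point-dependent cofactors
(for `Φ = axialAvg`: `exists_axialAvg_shear`).  Written for the N08 seat's (β4) milestone (M4) («one isolated firing is invisible two levels up», `pub-ymgap-dag-n08-d` g47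
02:25Z (125)); complements g47's symmetry∕Weil core (124) (point-INDEPENDENT one-sided translations) — here the cofactors `A`, `B` may depend on the point, which is the case for
composites, and the source measure need not have a density (level k+1 carries `Haar ⊗ law(fired variable)`, possibly singular in the fired coordinate).

CONTENTS ([folklore] measure theory; `X` any measurable space, target `GaugeField P j′ G` with product Haar `dU_{j′}`):
* ★★★ `map_eq_smul_of_translateSlots` — `μ` s-finite on `X`, `Φ` measurable, `σ : (coarse fields) → X → X` jointly measurable with `μ∘σ_κ⁻¹ = μ` and the translate property
  ⇒ `μ.map Φ = μ(univ) • dU_{j′}`.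
* ★★ `map_withDensity_eq_smul_of_translateSlots` — density form: `ν` with measure-PRESERVING shears, `f ≥ 0` measurable with `f∘σ_κ = f` ⇒ `((ν.withDensity f).map Φ) = (∫⁻ f dν)•dU_{j′}`.
* ★★ `map_prod_eq_of_translateSlots` — spectator form: `μ` finite, `φ : X → Y` measurable with `φ∘σ_κ = φ` ⇒ `μ.map (x ↦ (φ x, Φ x)) = (μ.map φ) ⊗ dU_{j′}`.
* ★ `integral_comp_mul_eq_of_translateSlots` — signed form: `ν` σ-preserved, `f` integrable with `f∘σ_κ = f`, `g` bounded measurable ⇒ `∫ g(Φ x)·f(x) dν = (∫ g dU_{j′})·(∫ f dν)`.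
* `map_axialAvg_eq_smul_of_shearInvariant` — the instance `Φ = axialAvg`, `σ_κ U = U·ext(κ)` (free slots `t(c) < L`): every s-finite SHEAR-INVARIANT measure on the fine fields is
  pushed to `μ(univ)•dU_{j+1}` (p755566's theorem without the density).

HONEST SCOPE.  [folklore] measure theory; nothing of hTop ∕ (M4) ∕ hJ ∕ `HistoryTailL` (19936) ∕ the rung ∕ d = 4 ∕ a mass gap ∕ Clay is proved here.  YM₃ on T³ is rung R3 of the ladder, not the
Clay problem.

References: T. Bałaban, Commun. Math. Phys. **109** (1987) 249–301 [Balaban1987RG1] ((0.4) p. 253, (0.11) p. 253: the composite averagings); T. Bałaban, Commun. Math. Phys. **98**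
(1985) 17–51 [Balaban1985Averaging] ((10) p. 19: product Haar).
-/

set_option autoImplicit false

noncomputable section

open MeasureTheory
open scoped ENNReal

namespace Summit.QuantumFields.YangMills.Theorems.UV3AxialLaunderingTranslateSlots

open Literature.MathematicalPhysics.QuantumFieldTheory.Balaban1983to89
open Literature.MathematicalPhysics.QuantumFieldTheory.Balaban1983to89.AveragingRT
open Summit.QuantumFields.YangMills.Theorems.UV3AxialLaunderingFreeSlot

variable {P : Params} {j' : ℕ} {G : Type*} [GaugeGroup G] [MeasurableSpace G] [HaarData G] [MeasurableMul₂ G]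
  {X : Type*} [MeasurableSpace X]

/-! ## §1 The core: shear-invariant measures are pushed to multiples of product Haar -/

omit [MeasurableSpace X] in
/-- For fixed `x`, a map with the translate property is measure-preserving on the coarse fields: `κ ↦ Φ(σ_κ x) = (A_C κ_C B_C)_C` is a two-sided coordinatewise translation
(lit `measurePreserving_mulLeft`∕`measurePreserving_mulRight`). [cite: Balaban1985Averaging, (10) p.19] -/
theorem measurePreserving_of_translate (Φ : X → GaugeField P j' G) (σ : GaugeField P j' G → X → X) (x : X)
    (htr : ∃ A B : GaugeField P j' G, ∀ κ : GaugeField P j' G, Φ (σ κ x) = fun C => A C * κ C * B C) :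
    MeasurePreserving (fun κ : GaugeField P j' G => Φ (σ κ x)) (fieldMeasure P j' G) (fieldMeasure P j' G) := by
  obtain ⟨A, B, hAB⟩ := htr
  have hcomp : (fun κ : GaugeField P j' G => Φ (σ κ x)) =
      (fun (v : GaugeField P j' G) (C : PBond P j') => v C * B C) ∘ (fun (κ : GaugeField P j' G) (C : PBond P j') => A C * κ C) := by
    funext κ; rw [hAB κ]; rfl
  rw [hcomp]
  exact (measurePreserving_mulRight B).comp (measurePreserving_mulLeft A)

/-- ★★★ **LAUNDERING BY TRANSLATE SLOTS.**  Let `μ` be an s-finite measure on `X`, `Φ : X → (coarse fields)` measurable, and `σ_κ : X → X` (`κ` a coarse field) a jointly measurable family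
with `μ∘σ_κ⁻¹ = μ` for every `κ`, such that for every point `x` there are coarse fields `A`, `B` with `Φ(σ_κ x) = (A_C·κ_C·B_C)_C` for all `κ`.  Then `μ∘Φ⁻¹ = μ(univ)•dU_{j′}`.
Route: `μ(Φ⁻¹A) = ∫ 1_A(Φ(σ_κ x)) dμ` for every `κ` (invariance); average over `κ ∼ dU_{j′}` (a probability), swap (Tonelli), and the inner `κ`-integral is `dU_{j′}(A)` by
`measurePreserving_of_translate`. [cite: Balaban1987RG1, (0.11) p.253; Balaban1985Averaging, (10) p.19] -/
theorem map_eq_smul_of_translateSlots (μ : Measure X) [SFinite μ] (Φ : X → GaugeField P j' G) (hΦ : Measurable Φ)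
    (σ : GaugeField P j' G → X → X) (hσm : Measurable fun p : X × GaugeField P j' G => σ p.2 p.1)
    (hσμ : ∀ κ : GaugeField P j' G, μ.map (σ κ) = μ)
    (htr : ∀ x : X, ∃ A B : GaugeField P j' G, ∀ κ : GaugeField P j' G, Φ (σ κ x) = fun C => A C * κ C * B C) :
    μ.map Φ = μ Set.univ • fieldMeasure P j' G := by
  have hσk : ∀ κ : GaugeField P j' G, Measurable (σ κ) := fun κ =>
    hσm.comp (measurable_id.prodMk measurable_const)
  ext A hA
  rw [Measure.map_apply hΦ hA, Measure.smul_apply, smul_eq_mul]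
  have hind : Measurable fun V : GaugeField P j' G => A.indicator (fun _ => (1 : ℝ≥0∞)) V := measurable_const.indicator hA
  -- `μ(Φ⁻¹A) = ∫ 1_A ∘ Φ`
  have h0 : μ (Φ ⁻¹' A) = ∫⁻ x, A.indicator (fun _ => (1 : ℝ≥0∞)) (Φ x) ∂μ := by
    rw [← lintegral_indicator_one (hΦ hA)]
    refine lintegral_congr fun x => ?_
    by_cases hx : Φ x ∈ A
    · rw [Set.indicator_of_mem (show x ∈ Φ ⁻¹' A from hx), Set.indicator_of_mem hx, Pi.one_apply]
    · rw [Set.indicator_of_notMem (show x ∉ Φ ⁻¹' A from hx), Set.indicator_of_notMem hx]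
  rw [h0]
  -- the two-variable integrand
  set F : X → GaugeField P j' G → ℝ≥0∞ := fun x κ => A.indicator (fun _ => (1 : ℝ≥0∞)) (Φ (σ κ x)) with hF
  have hFm : Measurable (Function.uncurry F) := hind.comp (hΦ.comp hσm)
  -- (i) invariance under each shear
  have hstep : ∀ κ : GaugeField P j' G, ∫⁻ x, A.indicator (fun _ => (1 : ℝ≥0∞)) (Φ x) ∂μ = ∫⁻ x, F x κ ∂μ := by
    intro κ
    have h1 := lintegral_map (μ := μ) (hind.comp hΦ) (hσk κ)
    rw [hσμ κ] at h1
    exact h1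
  -- (ii) average and swap
  have havg : ∫⁻ x, A.indicator (fun _ => (1 : ℝ≥0∞)) (Φ x) ∂μ = ∫⁻ κ, ∫⁻ x, F x κ ∂μ ∂(fieldMeasure P j' G) := by
    simp_rw [← hstep]
    rw [lintegral_const, measure_univ, mul_one]
  have hFm' : Measurable (Function.uncurry fun (κ : GaugeField P j' G) (x : X) => F x κ) := hFm.comp measurable_swap
  rw [havg, lintegral_lintegral_swap hFm'.aemeasurable]
  -- (iii) the inner integral
  have hinner : ∀ x : X, ∫⁻ κ, F x κ ∂(fieldMeasure P j' G) = fieldMeasure P j' G A := by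
    intro x
    have hΛ := measurePreserving_of_translate Φ σ x (htr x)
    have := hΛ.lintegral_comp hind
    rw [lintegral_indicator_const hA, one_mul] at this
    exact this
  simp_rw [hinner]
  rw [lintegral_const, mul_comm]

/-! ## §2 Density, spectator and signed forms -/

/-- ★★ **DENSITY FORM**: shears PRESERVING a reference measure `ν` and fixing a measurable density `f ≥ 0` ⇒ `((ν.withDensity f)∘Φ⁻¹) = (∫⁻ f dν)•dU_{j′}`.
[cite: Balaban1987RG1, (0.11) p.253; Balaban1985Averaging, (10) p.19] -/
theorem map_withDensity_eq_smul_of_translateSlots (ν : Measure X) [SFinite ν] (Φ : X → GaugeField P j' G) (hΦ : Measurable Φ)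
    (σ : GaugeField P j' G → X → X) (hσm : Measurable fun p : X × GaugeField P j' G => σ p.2 p.1)
    (hσν : ∀ κ : GaugeField P j' G, MeasurePreserving (σ κ) ν ν)
    (htr : ∀ x : X, ∃ A B : GaugeField P j' G, ∀ κ : GaugeField P j' G, Φ (σ κ x) = fun C => A C * κ C * B C)
    {f : X → ℝ≥0∞} (hf : Measurable f) (hfσ : ∀ (κ : GaugeField P j' G) (x : X), f (σ κ x) = f x) :
    (ν.withDensity f).map Φ = (∫⁻ x, f x ∂ν) • fieldMeasure P j' G := by
  have hinv : ∀ κ : GaugeField P j' G, (ν.withDensity f).map (σ κ) = ν.withDensity f := by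
    intro κ
    ext A hA
    rw [Measure.map_apply (hσν κ).measurable hA, withDensity_apply _ ((hσν κ).measurable hA), withDensity_apply _ hA]
    calc ∫⁻ x in σ κ ⁻¹' A, f x ∂ν = ∫⁻ x in σ κ ⁻¹' A, f (σ κ x) ∂ν := by simp only [hfσ]
      _ = ∫⁻ y in A, f y ∂(ν.map (σ κ)) := (setLIntegral_map hA hf (hσν κ).measurable).symm
      _ = ∫⁻ y in A, f y ∂ν := by rw [(hσν κ).map_eq]
  rw [map_eq_smul_of_translateSlots (ν.withDensity f) Φ hΦ σ hσm hinv htr, withDensity_apply _ MeasurableSet.univ,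
    Measure.restrict_univ]

/-- ★★ **SPECTATOR FORM**: `μ` finite and shear-invariant, `φ : X → Y` measurable and shear-blind ⇒ `μ∘(φ, Φ)⁻¹ = (μ∘φ⁻¹) ⊗ dU_{j′}` — the laundered coarse field is exactly Haar
AND independent of the spectator (rectangles: the restriction `μ↾{φ ∈ B}` is again shear-invariant; §1). [cite: Balaban1987RG1, (0.11) p.253; Balaban1985Averaging, (10) p.19] -/
theorem map_prod_eq_of_translateSlots {Y : Type*} [MeasurableSpace Y] (μ : Measure X) [IsFiniteMeasure μ]
    (Φ : X → GaugeField P j' G) (hΦ : Measurable Φ)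
    (σ : GaugeField P j' G → X → X) (hσm : Measurable fun p : X × GaugeField P j' G => σ p.2 p.1)
    (hσμ : ∀ κ : GaugeField P j' G, μ.map (σ κ) = μ)
    (htr : ∀ x : X, ∃ A B : GaugeField P j' G, ∀ κ : GaugeField P j' G, Φ (σ κ x) = fun C => A C * κ C * B C)
    {φ : X → Y} (hφ : Measurable φ) (hφσ : ∀ (κ : GaugeField P j' G) (x : X), φ (σ κ x) = φ x) :
    μ.map (fun x => (φ x, Φ x)) = (μ.map φ).prod (fieldMeasure P j' G) := by
  have hσk : ∀ κ : GaugeField P j' G, Measurable (σ κ) := fun κ =>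
    hσm.comp (measurable_id.prodMk measurable_const)
  have hpair : Measurable fun x : X => (φ x, Φ x) := hφ.prodMk hΦ
  haveI : IsFiniteMeasure (μ.map φ) := Measure.isFiniteMeasure_map _ _
  haveI : IsFiniteMeasure (μ.map fun x => (φ x, Φ x)) := Measure.isFiniteMeasure_map _ _
  symm
  refine Measure.prod_eq fun B A hB hA => ?_
  -- the restriction to `{φ ∈ B}` is shear-invariant
  have hinvB : ∀ κ : GaugeField P j' G, (μ.restrict (φ ⁻¹' B)).map (σ κ) = μ.restrict (φ ⁻¹' B) := by
    intro κ
    have hpre : σ κ ⁻¹' (φ ⁻¹' B) = φ ⁻¹' B := by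
      ext x
      simp only [Set.mem_preimage, hφσ κ x]
    ext E hE
    rw [Measure.map_apply (hσk κ) hE, Measure.restrict_apply ((hσk κ) hE), Measure.restrict_apply hE]
    conv_lhs => rw [← hpre]
    rw [← Set.preimage_inter, ← Measure.map_apply (hσk κ) (hE.inter (hφ hB)), hσμ κ]
  have key := map_eq_smul_of_translateSlots (μ.restrict (φ ⁻¹' B)) Φ hΦ σ hσm hinvB htr
  have hkeyA := congrArg (fun m : Measure (GaugeField P j' G) => m A) key
  simp only [Measure.map_apply hΦ hA, Measure.restrict_apply (hΦ hA), Measure.smul_apply, smul_eq_mul,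
    Measure.restrict_apply MeasurableSet.univ, Set.univ_inter] at hkeyA
  rw [Measure.map_apply hpair (hB.prod hA), Measure.map_apply hφ hB]
  have hset : (fun x => (φ x, Φ x)) ⁻¹' (B ×ˢ A) = Φ ⁻¹' A ∩ φ ⁻¹' B := by
    ext x
    simp only [Set.mem_preimage, Set.mem_prod, Set.mem_inter_iff]
    exact and_comm
  rw [hset, hkeyA, mul_comm]

/-- ★ **SIGNED (BOCHNER) FORM**: `ν` preserved by the shears, `f : X → ℝ` integrable with `f∘σ_κ = f`, `g` bounded measurable on the coarse fields ⇒
`∫ g(Φ x)·f(x) dν = (∫ g dU_{j′})·(∫ f dν)`. [cite: Balaban1987RG1, (0.11) p.253; Balaban1985Averaging, (10) p.19] -/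
theorem integral_comp_mul_eq_of_translateSlots (ν : Measure X) [SFinite ν] (Φ : X → GaugeField P j' G) (hΦ : Measurable Φ)
    (σ : GaugeField P j' G → X → X) (hσm : Measurable fun p : X × GaugeField P j' G => σ p.2 p.1)
    (hσν : ∀ κ : GaugeField P j' G, MeasurePreserving (σ κ) ν ν)
    (htr : ∀ x : X, ∃ A B : GaugeField P j' G, ∀ κ : GaugeField P j' G, Φ (σ κ x) = fun C => A C * κ C * B C)
    {f : X → ℝ} (hf : Integrable f ν) (hfσ : ∀ (κ : GaugeField P j' G) (x : X), f (σ κ x) = f x)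
    {g : GaugeField P j' G → ℝ} (hg : Measurable g) (Cg : ℝ) (hgC : ∀ V, |g V| ≤ Cg) :
    ∫ x, g (Φ x) * f x ∂ν = (∫ V, g V ∂(fieldMeasure P j' G)) * ∫ x, f x ∂ν := by
  set F : GaugeField P j' G → X → ℝ := fun κ x => g (Φ (σ κ x)) * f x with hF
  -- (i) invariance under each shear
  have hstep : ∀ κ : GaugeField P j' G, ∫ x, g (Φ x) * f x ∂ν = ∫ x, F κ x ∂ν := by
    intro κ
    have hG : AEStronglyMeasurable (fun x : X => g (Φ x) * f x) ν :=
      (hg.comp hΦ).aestronglyMeasurable.mul hf.aestronglyMeasurable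
    have h1 := integral_map (μ := ν) (hσν κ).measurable.aemeasurable (f := fun x : X => g (Φ x) * f x)
      (hG.mono_measure (le_of_eq (hσν κ).map_eq))
    rw [(hσν κ).map_eq] at h1
    refine h1.trans (integral_congr_ae (Filter.Eventually.of_forall fun x => ?_))
    show g (Φ (σ κ x)) * f (σ κ x) = g (Φ (σ κ x)) * f x
    rw [hfσ κ x]
  -- (ii) average and swap
  have havg : ∫ x, g (Φ x) * f x ∂ν = ∫ κ, ∫ x, F κ x ∂ν ∂(fieldMeasure P j' G) := by
    simp_rw [← hstep]
    rw [integral_const, probReal_univ, one_smul]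
  have hFint : Integrable (Function.uncurry F) ((fieldMeasure P j' G).prod ν) := by
    have hf2 : Integrable (fun p : GaugeField P j' G × X => f p.2) ((fieldMeasure P j' G).prod ν) := hf.comp_snd _
    have hgm : AEStronglyMeasurable (fun p : GaugeField P j' G × X => g (Φ (σ p.1 p.2))) ((fieldMeasure P j' G).prod ν) :=
      (hg.comp (hΦ.comp (hσm.comp (measurable_snd.prodMk measurable_fst)))).aestronglyMeasurable
    refine (hf2.bdd_mul (c := Cg) hgm (Filter.Eventually.of_forall fun p => ?_)).congr ?_
    · rw [Real.norm_eq_abs]; exact hgC _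
    · exact Filter.Eventually.of_forall fun p => rfl
  rw [havg, integral_integral_swap hFint]
  -- (iii) inner integral
  have hinner : ∀ x : X, ∫ κ, F κ x ∂(fieldMeasure P j' G) = (∫ V, g V ∂(fieldMeasure P j' G)) * f x := by
    intro x
    show ∫ κ, g (Φ (σ κ x)) * f x ∂(fieldMeasure P j' G) = _
    rw [integral_mul_const]
    congr 1
    have hΛ := measurePreserving_of_translate Φ σ x (htr x)
    have h := integral_map (μ := fieldMeasure P j' G) hΛ.measurable.aemeasurable (f := g)
      (hg.aestronglyMeasurable.mono_measure (le_of_eq hΛ.map_eq))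
    rw [hΛ.map_eq] at h
    exact h.symm
  simp_rw [hinner]
  rw [integral_const_mul]

/-! ## §3 Instance: shear-invariant measures on the fine fields under the straight transporter -/

/-- ★ **EVERY s-FINITE SHEAR-INVARIANT MEASURE ON THE FINE FIELDS IS LAUNDERED BY THE STRAIGHT TRANSPORTER**: slots `t(c) < L`; if `μ∘(U ↦ U·ext k)⁻¹ = μ` for every coarse
field `k`, then `μ∘Ū_ax⁻¹ = μ(univ)•dU_{j+1}` (no density needed; §1 at `Φ := axialAvg`, ✓`exists_axialAvg_shear`, ✓`measurable_shear`). [cite: Balaban1987RG1, (0.4) p.253; Balaban1985Averaging, (10) p.19] -/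
theorem map_axialAvg_eq_smul_of_shearInvariant {j : ℕ} (hj : j + 1 ≤ P.m + P.K) (t : PBond P (j + 1) → ℕ) (ht : ∀ c, t c < P.L)
    (μ : Measure (GaugeField P j G)) [SFinite μ]
    (hμ : ∀ k : GaugeField P (j + 1) G,
      μ.map (fun U : GaugeField P j G => fun b => U b * Function.extend (fun c : PBond P (j + 1) => line c (t c)) k (fun _ => 1) b) = μ) :
    μ.map (axialAvg : GaugeField P j G → GaugeField P (j + 1) G) = μ Set.univ • fieldMeasure P (j + 1) G :=
  map_eq_smul_of_translateSlots μ axialAvg measurable_axialAvg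
    (fun (k : GaugeField P (j + 1) G) (U : GaugeField P j G) => fun b =>
      U b * Function.extend (fun c : PBond P (j + 1) => line c (t c)) k (fun _ => 1) b)
    (measurable_shear hj t ht) hμ (exists_axialAvg_shear hj t ht)

end Summit.QuantumFields.YangMills.Theorems.UV3AxialLaunderingTranslateSlots

end
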